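import Summits.ResolutionOfSingularities.ResolutionOfSingularities.Theorems.HilbertSamuelEliminationSigmaMaxModificationsCorridor3WLadderSegmentsTowerU
import HarnessLib

/-!
# [OURS · L1 W4.2] THE REPAIRED UNIT TOWER, II: initial point, terminal point, and the link to the next unit — for `Seg.unitTowerU`
# (crux `SigmaMaxModifications` stmt-ResolutionOfSingularities-18506; conjunct `SigmaMaxModificationsCorridor3` stmt-…-19249; line `w_ladder`; U-seg repair)

Stub worker res-L1-w42-stub-1 (gen 4). Helper file `--supports stmt-ResolutionOfSingularities-19249 --as helper`; kernel only, no named fact, no new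
definition. The statements of `…Corridor3WLadderSegmentsTowerEnds` (gen 3) re-derived VERBATIM for the repaired unit tower `Seg.unitTowerU`
(compression inside the unit only, `…SegmentsTowerU`): initial point closed with `e`/`ē`/`H` of `x_b`, `C_0 = {𝔪_{x_b}}` at a blown-up
stratum-isolated base; terminal point `termPtU` closed, over the initial point, with `e`/`ē`/`H` of `x_{b'}`, `b' = Seg.nextBaseU b`; and the
link of CJS Def. 6.39 read locally (`isLocalSchemeAt_unitTowerU_terminal`).

OURS bookkeeping; NOT a statement of the manuscript [Hironaka2017] nor of [CossartJannsenSaito2020]. AI-written; AI review is weaker than expert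
review.

References: V. Cossart, U. Jannsen, S. Saito, LNM 2270 (2020), Def. 6.38, Def. 6.39, p. 107 [CossartJannsenSaito2020].
-/

noncomputable section

set_option linter.dupNamespace false -- namespace `…Corridor3.Moving` re-enters `…Corridor3` (module convention of the Moving files)

open CategoryTheory AlgebraicGeometry TopologicalSpace Topology IsLocalRing
open Literature.AlgebraicGeometry.Resolution Literature.RingTheory.HilbertSamuel
open Literature.AlgebraicGeometry.CossartJannsenSaito2020
open Summit.ResolutionOfSingularities.ResolutionOfSingularities.Theorems.CampaignW42
open Summit.ResolutionOfSingularities.ResolutionOfSingularities.Theorems.SigmaMaxModificationsCorridor3.Helpers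

namespace Summit.ResolutionOfSingularities.ResolutionOfSingularities.Theorems.SigmaMaxModificationsCorridor3.Moving.Seg

universe u

variable {R : ∀ S : Scheme.{u}, CentreSeq S → Prop} {N : ℕ} {ν : ℕ → ℕ} {k : Type u} [Field k]

section Unit

variable {c : ℕ → MarkedStage.{u}} (hc : ∀ n, CanonicalNearStep R N ν (c n) (c (n + 1))) (hRa : OracleAdmissible R)
  (hν : ν ≠ iterPSum N Phi) (h0 : Helpers.CycleInv k N ν (c 0)) (hgen : ∀ n, ∃ m, n ≤ m ∧ (c m).IsBlownUp R N ν)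
  (hBG : ∀ n, ∃ m, n ≤ m ∧ (c m).IsBlownUp R N ν ∧ Iso N (c m))

/-! ### The initial point -/

/-- The initial point is closed. [cite: CossartJannsenSaito2020, Def. 6.38 (i)] -/
theorem isClosed_basePtU (b : ℕ) (hemp : HEmpU hc hRa hν h0 hgen hBG b) :
    IsClosed ({basePt hc hRa hν h0 b} : Set ((unitTowerU hc hRa hν h0 hgen hBG b hemp).X 0)) :=
  isClosed_singleton_closedPoint _

/-- `e` at the initial point is `e_{x_b}(X_b)`. [cite: CossartJannsenSaito2020, Lemma 2.27 (3)] -/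
theorem dirDimAt_unitTowerU_zero (b : ℕ) (hemp : HEmpU hc hRa hν h0 hgen hBG b) :
    (unitTowerU hc hRa hν h0 hgen hBG b hemp).dirDimAt 0 (basePt hc hRa hν h0 b) = dirDim (c b) := by
  haveI : IsLocallyNoetherian (c b).W := (c b).ln
  exact Scheme.dirDim_fromSpecStalk_closedPoint (c b).W (c b).pt

/-- `ē` at the initial point is `ē_{x_b}(X_b)`. [cite: CossartJannsenSaito2020, Lemma 2.27 (3)] -/
theorem geomDirDimAt_unitTowerU_zero (b : ℕ) (hemp : HEmpU hc hRa hν h0 hgen hBG b) :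
    (unitTowerU hc hRa hν h0 hgen hBG b hemp).geomDirDimAt 0 (basePt hc hRa hν h0 b) = (c b).geomDirDim := by
  haveI : IsLocallyNoetherian (c b).W := (c b).ln
  exact Scheme.geomDirDim_fromSpecStalk_closedPoint (c b).W (c b).pt

/-- `H` at the initial point is `H_{X_b}(x_b)`. [cite: CossartJannsenSaito2020, Lemma 2.27 (1)] -/
theorem hsFun_unitTowerU_zero (b : ℕ) (hemp : HEmpU hc hRa hν h0 hgen hBG b) :
    Scheme.hsFun ((unitTowerU hc hRa hν h0 hgen hBG b hemp).X 0) N (basePt hc hRa hν h0 b) = Scheme.hsFun (c b).W N (c b).pt := by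
  haveI : IsLocallyNoetherian (c b).W := (c b).ln
  exact Scheme.hsFun_fromSpecStalk_closedPoint (c b).W (c b).pt N

/-- **`C_0 = {𝔪_{x_b}}`** when `b` is BLOWN UP at a marked point ISOLATED IN ITS `ν`-STRATUM, along a chain from a maximal origin (functional
admissible oracle): the canonical centre through `x_b` has stalk `𝔪_{x_b}` (`…WLadderUnitStart`), and a point of `Spec 𝒪_{X_b,x_b}` lies in the
preimage of `V(C)` iff `C_{x_b} ≤` its prime. [cite: CossartJannsenSaito2020, Def. 6.38 (ii)] -/
theorem unitTowerU_C_zero (hRf : OracleFunctional R) {p : ℕ} {X : Scheme.{u}} [IsLocallyNoetherian X] {x : X}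
    (hX : IsMaximalOrigin p N ν X x) (b : ℕ) (hemp : HEmpU hc hRa hν h0 hgen hBG b) (hreach : Reaches R N ν (MarkedStage.init X x) (c b))
    (hb : (c b).IsBlownUp R N ν)
    (hU : ∃ U : Set (c b).W, IsOpen U ∧ (c b).pt ∈ U ∧ U ∩ Scheme.hsStratum (c b).W N ν ⊆ {(c b).pt}) :
    (unitTowerU hc hRa hν h0 hgen hBG b hemp).C 0 = {basePt hc hRa hν h0 b} := by
  obtain ⟨P', hst⟩ := Helpers.isCanonicalStep_chainCentre (shiftStep hc b) 0
  have hmem : (c b).pt ∈ ((Helpers.chainCentre (shiftStep hc b) 0).support : Set (c b).W) :=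
    (pt_mem_upTower_C_iff hc hRa hν h0 hRf b 0).mpr hb
  have hmax : stalkIdeal (Helpers.chainCentre (shiftStep hc b) 0) (c b).pt = maximalIdeal ((c b).W.presheaf.stalk (c b).pt) :=
    hX.stalkIdeal_centre_eq_maximalIdeal_of_stratumIsolated hRa hν hreach hU hst hmem
  show ((c b).W.fromSpecStalk (c b).pt).base ⁻¹' ((Helpers.chainCentre (shiftStep hc b) 0).support : Set (c b).W) = _
  ext s
  refine (fromSpecStalk_mem_support_iff_stalkIdeal_le (Helpers.chainCentre (shiftStep hc b) 0) s).trans ?_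
  rw [hmax]
  constructor
  · intro h
    exact PrimeSpectrum.ext ((maximalIdeal.isMaximal _).eq_of_le s.2.ne_top h).symm
  · intro h
    rw [Set.mem_singleton_iff.mp h]
    exact le_rfl

/-! ### The terminal point -/

/-- The terminal point is closed (it lies over the closed point `x_{b'}` and `ι` is injective and continuous), along a chain from a closed
point. [cite: CossartJannsenSaito2020, Def. 6.38 (vi)] -/
theorem isClosed_termPtU {X : Scheme.{u}} [IsLocallyNoetherian X] {x : X} (hx : IsClosed ({x} : Set X)) (b : ℕ)
    (hemp : HEmpU hc hRa hν h0 hgen hBG b) (hreach : Reaches R N ν (MarkedStage.init X x) (c (Seg.nextBaseU hgen hBG b))) :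
    IsClosed ({termPtU hc hRa hν h0 hgen hBG b hemp} : Set ((unitTowerU hc hRa hν h0 hgen hBG b hemp).X (unitLen hgen hBG b))) := by
  haveI : IsLocallyNoetherian ((upTower hc hRa hν h0 b).X 0) := (upTower hc hRa hν h0 b).ln 0
  refine (upTower hc hRa hν h0 b).isClosed_singleton_of_bcι _ _ (termPtU hc hRa hν h0 hgen hBG b hemp) ?_
  rw [show ((upTower hc hRa hν h0 b).bcι _ _).base (termPtU hc hRa hν h0 hgen hBG b hemp) = (c (Seg.nextBaseU hgen hBG b)).pt from
    locι_termPtU hc hRa hν h0 hgen hBG b hemp]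
  exact Reaches.isClosed_pt hx hreach

/-- `H` at the terminal point is `H_{X_{b'}}(x_{b'})`. [cite: CossartJannsenSaito2020, Lemma 2.27 (1)] -/
theorem hsFun_unitTowerU_terminal (b : ℕ) (hemp : HEmpU hc hRa hν h0 hgen hBG b) :
    Scheme.hsFun ((unitTowerU hc hRa hν h0 hgen hBG b hemp).X (unitLen hgen hBG b)) N (termPtU hc hRa hν h0 hgen hBG b hemp) =
      Scheme.hsFun (c (Seg.nextBaseU hgen hBG b)).W N (c (Seg.nextBaseU hgen hBG b)).pt := by
  haveI : IsLocallyNoetherian ((upTower hc hRa hν h0 b).X 0) := (upTower hc hRa hν h0 b).ln 0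
  haveI := flat_fromSpecStalk ((upTower hc hRa hν h0 b).X 0) ((c b).pt : (upTower hc hRa hν h0 b).X 0)
  rw [← locι_termPtU hc hRa hν h0 hgen hBG b hemp]
  exact (upTower hc hRa hν h0 b).hsFun_baseChange _ N _ _

/-- `e` at the terminal point is `e_{x_{b'}}(X_{b'})`. [cite: CossartJannsenSaito2020, Lemma 2.27 (3)] -/
theorem dirDimAt_unitTowerU_terminal (b : ℕ) (hemp : HEmpU hc hRa hν h0 hgen hBG b) :
    (unitTowerU hc hRa hν h0 hgen hBG b hemp).dirDimAt (unitLen hgen hBG b) (termPtU hc hRa hν h0 hgen hBG b hemp) =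
      dirDim (c (Seg.nextBaseU hgen hBG b)) := by
  haveI : IsLocallyNoetherian ((upTower hc hRa hν h0 b).X 0) := (upTower hc hRa hν h0 b).ln 0
  haveI := flat_fromSpecStalk ((upTower hc hRa hν h0 b).X 0) ((c b).pt : (upTower hc hRa hν h0 b).X 0)
  calc (unitTowerU hc hRa hν h0 hgen hBG b hemp).dirDimAt (unitLen hgen hBG b) (termPtU hc hRa hν h0 hgen hBG b hemp)
      = (upTower hc hRa hν h0 b).dirDimAt _ ((locι hc hRa hν h0 b (termIdxU hgen hBG b)).base (termPtU hc hRa hν h0 hgen hBG b hemp)) :=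
        (upTower hc hRa hν h0 b).dirDimAt_baseChange _ _ _
    _ = (upTower hc hRa hν h0 b).dirDimAt _ (c (Seg.nextBaseU hgen hBG b)).pt := by rw [locι_termPtU]
    _ = dirDim (c (Seg.nextBaseU hgen hBG b)) := rfl

/-- `ē` at the terminal point is `ē_{x_{b'}}(X_{b'})`. [cite: CossartJannsenSaito2020, Lemma 2.27 (3)] -/
theorem geomDirDimAt_unitTowerU_terminal (b : ℕ) (hemp : HEmpU hc hRa hν h0 hgen hBG b) :
    (unitTowerU hc hRa hν h0 hgen hBG b hemp).geomDirDimAt (unitLen hgen hBG b) (termPtU hc hRa hν h0 hgen hBG b hemp) =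
      (c (Seg.nextBaseU hgen hBG b)).geomDirDim := by
  haveI : IsLocallyNoetherian ((upTower hc hRa hν h0 b).X 0) := (upTower hc hRa hν h0 b).ln 0
  haveI := flat_fromSpecStalk ((upTower hc hRa hν h0 b).X 0) ((c b).pt : (upTower hc hRa hν h0 b).X 0)
  calc (unitTowerU hc hRa hν h0 hgen hBG b hemp).geomDirDimAt (unitLen hgen hBG b) (termPtU hc hRa hν h0 hgen hBG b hemp)
      = (upTower hc hRa hν h0 b).geomDirDimAt _ ((locι hc hRa hν h0 b (termIdxU hgen hBG b)).base (termPtU hc hRa hν h0 hgen hBG b hemp)) :=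
        (upTower hc hRa hν h0 b).geomDirDimAt_baseChange _ _ _
    _ = (upTower hc hRa hν h0 b).geomDirDimAt _ (c (Seg.nextBaseU hgen hBG b)).pt := by rw [locι_termPtU]
    _ = (c (Seg.nextBaseU hgen hBG b)).geomDirDim := rfl

/-- **The terminal point lies over the initial point**: `φ_m(x_m) = 𝔪_{x_b}`. [cite: CossartJannsenSaito2020, Def. 6.38 (vi)] -/
theorem phi_termPtU (b : ℕ) (hemp : HEmpU hc hRa hν h0 hgen hBG b) :
    ((unitTowerU hc hRa hν h0 hgen hBG b hemp).phi (unitLen hgen hBG b)).base (termPtU hc hRa hν h0 hgen hBG b hemp) =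
      basePt hc hRa hν h0 b := by
  haveI : IsLocallyNoetherian ((upTower hc hRa hν h0 b).X 0) := (upTower hc hRa hν h0 b).ln 0
  haveI := flat_fromSpecStalk ((upTower hc hRa hν h0 b).X 0) ((c b).pt : (upTower hc hRa hν h0 b).X 0)
  have hφ : (unitTowerU hc hRa hν h0 hgen hBG b hemp).phi (unitLen hgen hBG b) = (locTower hc hRa hν h0 b).phi (termIdxU hgen hBG b) :=
    (locTower hc hRa hν h0 b).compress_phi_zero (htriv_of_hEmpU hc hRa hν h0 hgen hBG hemp) _
  rw [hφ]
  apply (((upTower hc hRa hν h0 b).X 0).fromSpecStalk ((c b).pt : (upTower hc hRa hν h0 b).X 0)).isEmbedding.injective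
  have e1 : (locι hc hRa hν h0 b 0).base (((locTower hc hRa hν h0 b).phi (termIdxU hgen hBG b)).base (termPtU hc hRa hν h0 hgen hBG b hemp))
      = ((upTower hc hRa hν h0 b).phi (termIdxU hgen hBG b)).base
          ((locι hc hRa hν h0 b (termIdxU hgen hBG b)).base (termPtU hc hRa hν h0 hgen hBG b hemp)) :=
    ((upTower hc hRa hν h0 b).phi_bcι_apply _ (termIdxU hgen hBG b) (termPtU hc hRa hν h0 hgen hBG b hemp)).symm
  have e2 : ((upTower hc hRa hν h0 b).phi (termIdxU hgen hBG b)).base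
      ((locι hc hRa hν h0 b (termIdxU hgen hBG b)).base (termPtU hc hRa hν h0 hgen hBG b hemp)) = (c b).pt := by
    rw [locι_termPtU]
    exact upTower_phi_pt hc hRa hν h0 b _
  exact e1.trans (e2.trans (locι_basePt hc hRa hν h0 b).symm)

/-! ### The link to the next unit -/

/-- **THE LINK (Def. 6.39 read locally): `Spec 𝒪_{X_{b'},x_{b'}}` is the local scheme of the unit's terminal stage at its terminal point**,
`b' = Seg.nextBase b` — the comparison map `ι` induces isomorphisms of local rings (053's `isIso_stalkMap_bcι`).
[cite: CossartJannsenSaito2020, Def. 6.39, p. 107] -/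
theorem isLocalSchemeAt_unitTowerU_terminal (b : ℕ) (hemp : HEmpU hc hRa hν h0 hgen hBG b) :
    IsLocalSchemeAt (Spec ((c (Seg.nextBaseU hgen hBG b)).W.presheaf.stalk (c (Seg.nextBaseU hgen hBG b)).pt))
      (closedPoint ((c (Seg.nextBaseU hgen hBG b)).W.presheaf.stalk (c (Seg.nextBaseU hgen hBG b)).pt))
      ((unitTowerU hc hRa hν h0 hgen hBG b hemp).X (unitLen hgen hBG b)) (termPtU hc hRa hν h0 hgen hBG b hemp) := by
  haveI : IsLocallyNoetherian ((upTower hc hRa hν h0 b).X 0) := (upTower hc hRa hν h0 b).ln 0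
  haveI := flat_fromSpecStalk ((upTower hc hRa hν h0 b).X 0) ((c b).pt : (upTower hc hRa hν h0 b).X 0)
  have h := isLocalSchemeAt_Spec_stalk_of_isIso_stalkMap (locι hc hRa hν h0 b (termIdxU hgen hBG b)) (termPtU hc hRa hν h0 hgen hBG b hemp)
    ((upTower hc hRa hν h0 b).isIso_stalkMap_bcι _ (termIdxU hgen hBG b) (termPtU hc hRa hν h0 hgen hBG b hemp))
  rw [locι_termPtU] at h
  exact h

end Unit


end Summit.ResolutionOfSingularities.ResolutionOfSingularities.Theorems.SigmaMaxModificationsCorridor3.Moving.Seg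

end
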